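import Summits.CriticalPhenomena.PercolationContinuityZ3.Theorems.PercNearOneGluingNoHeavyLowerTailKnQuestion8CoefficientwiseCoreClassKernelMixHat
import HarnessLib

/-!
# CW-PA on the core class over the hat of a cycle (THEOREM A-ARM BRIDGES, equal levels)

Support file (`--supports stmt-CriticalPhenomena-4575`, closed), prover `prim-cplus-coupling` (gen 37).  No definitions, no notations, no named facts,
no sorries; standard axioms.  Memo `prim-cplus-coupling/A5-COUPLING-gen37.md` §3.  Wrapper of `…KernelMixHat` through `cwpa_coreClass_of_kernelMixFull_allLevels`.
* `Coefficientwise.cwpa_coreClass_of_hat_deg_le_two` — for the middle graph `E' = EH + au + av` of `coreClass_kernelMixFull_hat_of_deg_le_two` (a new vertex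
  `a` joined to `u, v`; `EH` of maximum degree `2` away from `b` with the two forced-blue `b`-arcs — every cycle through `u, b, v`), the coefficientwise
  first rung CW-PA holds on prim-lf-2's core class `N(x) = N(z) = {a, b}` for ALL monotone `f, g`.
[cite: KozmaNitzan2024, Questions 8–9 (§5.5 p. 36) (context: the Question-8 pocket covariance programme)]
-/

namespace Summit.CriticalPhenomena.PercolationContinuityZ3.Theorems

open Finset Literature.Probability.Percolation

namespace Coefficientwise

variable {ι V : Type*}

open Classical in
/-- **CW-PA on the core class over the hat of a cycle (all lengths).**  Core class `N(x) = N(z) = {a, b}` (`E₀ = E' ∪ {ixa, ixb, iza, izb}`, no edge of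
`E'` at `x` or `z`) over the middle graph `E' = EH + au + av` of `coreClass_kernelMixFull_hat_of_deg_le_two` (the Wheatstone bridges with `a` adjacent to
both hubs; `EH` a cycle through `u, b, v` of any length): for ALL monotone `f, g`,
`0 ≤ Σ_{s ⊆ E₀ : z ∉ C_x(s), z ∉ C_x(E₀∖s)} f(C_x s)·(g(C_x s) − g(C_x(E₀∖s)))`. [cite: KozmaNitzan2024, Questions 8–9 (§5.5 p. 36) (context)] -/
theorem cwpa_coreClass_of_hat_deg_le_two (ends : ι → Sym2 V) (EH W₁ W₂ E₀ : Finset ι) (a u v b x z : V) (eu ev ixa ixb iza izb : ι)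
    (heu : ends eu = s(a, u)) (hev : ends ev = s(a, v)) (haH : ∀ i ∈ EH, a ∉ ends i)
    (hne : eu ≠ ev) (heuH : eu ∉ EH) (hevH : ev ∉ EH) (hau : a ≠ u) (hav : a ≠ v) (hab : a ≠ b)
    (hdeg : ∀ y, y ≠ b → ∀ i j l, i ∈ EH → j ∈ EH → l ∈ EH → y ∈ ends i → y ∈ ends j → y ∈ ends l → i = j ∨ i = l ∨ j = l)
    (hW₁E : W₁ ⊆ EH) (hW₁ne : W₁.Nonempty) (hW₁ub : b ∈ openCluster (ends '' (↑W₁ : Set ι)) u)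
    (hArc₁ : ∀ ω, ω ⊆ EH → u ∈ openCluster (ends '' (↑(EH \ ω) : Set ι)) b → v ∉ openCluster (ends '' (↑(EH \ ω) : Set ι)) b → Disjoint W₁ ω)
    (hW₂E : W₂ ⊆ EH) (hW₂ne : W₂.Nonempty) (hW₂vb : b ∈ openCluster (ends '' (↑W₂ : Set ι)) v)
    (hArc₂ : ∀ ω, ω ⊆ EH → v ∈ openCluster (ends '' (↑(EH \ ω) : Set ι)) b → u ∉ openCluster (ends '' (↑(EH \ ω) : Set ι)) b → Disjoint W₂ ω)
    (hxa : ends ixa = s(x, a)) (hxb : ends ixb = s(x, b)) (hza : ends iza = s(z, a)) (hzb : ends izb = s(z, b))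
    (hH : ∀ i ∈ insert eu (insert ev EH), x ∉ ends i ∧ z ∉ ends i)
    (hE₀ : ∀ i, i ∈ E₀ ↔ i ∈ insert eu (insert ev EH) ∨ i = ixa ∨ i = ixb ∨ i = iza ∨ i = izb)
    (hnot : ixa ∉ insert eu (insert ev EH) ∧ ixb ∉ insert eu (insert ev EH) ∧ iza ∉ insert eu (insert ev EH) ∧ izb ∉ insert eu (insert ev EH))
    (hd : ixa ≠ ixb ∧ ixa ≠ iza ∧ ixa ≠ izb ∧ ixb ≠ iza ∧ ixb ≠ izb ∧ iza ≠ izb)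
    (hxz : x ≠ z) (hxa' : x ≠ a) (hxb' : x ≠ b) (hza' : z ≠ a) (hzb' : z ≠ b)
    (f g : Set V → ℝ) (hf : Monotone f) (hg : Monotone g) :
    0 ≤ ∑ s ∈ E₀.powerset.filter (fun s : Finset ι => z ∉ openCluster (ends '' (↑s : Set ι)) x ∧ z ∉ openCluster (ends '' (↑(E₀ \ s) : Set ι)) x),
      f (openCluster (ends '' (↑s : Set ι)) x) * (g (openCluster (ends '' (↑s : Set ι)) x) - g (openCluster (ends '' (↑(E₀ \ s) : Set ι)) x)) :=
  cwpa_coreClass_of_kernelMixFull_allLevels ends (insert eu (insert ev EH)) E₀ x z a b ixa ixb iza izb hxa hxb hza hzb hH hE₀ hnot hd hxz hxa' hxb' hza' hzb'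
    (fun h k ha hb ka kb hh hk mha mhb mka mkb ha0 hah hb0 hbh ka0 kak kb0 kbk =>
      coreClass_kernelMixFull_hat_of_deg_le_two ends EH W₁ W₂ a u v b eu ev heu hev haH hne heuH hevH hau hav hab hdeg
        hW₁E hW₁ne hW₁ub hArc₁ hW₂E hW₂ne hW₂vb hArc₂ h k ha hb ka kb hh hk mha mhb mka mkb ha0 hah hb0 hbh ka0 kak kb0 kbk)
    f g hf hg

end Coefficientwise

end Summit.CriticalPhenomena.PercolationContinuityZ3.Theorems
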